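import Mathlib
import HarnessLib
import Summits.HubbardSuperconductivity.HubbardSuperconductivity.Theorems.BalabanIRBirGappedPhaseReductionRSlavedTrotterCore

/-!
# BalabanIR reduction `BirGappedPhaseReductionR` (stmt-14846): slaved pair field — MANY BLOCKS (per-slice estimate, configuration averages)

Support file (`--supports stmt-HubbardSuperconductivity-14846`; prover seat 2, session 11), fourth part
of the slaved pair-field dictionary of the crux card `slaved-pair-field-os-dictionary`.  The card
slaves a BLOCK pair field: a finite family of operators `B_b` (`b < m`, the block pair operators
`blockPair`), each with its own auxiliary field `φ_b`, penalty `(κ/2)Σ_b {B_b, B_bᴴ}` and, per time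
slice, the ordered product over blocks of the single-block source slices
`S_b(φ_b) = e^{aκ(conj φ_b B_b + φ_b B_bᴴ)}`.  This file lifts the single-block theory of
`…RSlavedTrotterCore` to `m` blocks WITHOUT new analysis:

* `sum_prod_ofFn_eq_prod_ofFn_sum` — distributivity of ORDERED products over finite sums (any
  semiring): `Σ_{p : Fin m → ι} Π_b F_b(p_b) = Π_b Σ_k F_b(k)`; hence the average over all field
  configurations of a slice factorises into the product of the per-block averaged slices
  (`avg_config_prod_eq_prod_avg`), and likewise over time slices;
* `norm_avgSlice_le` — `‖S̄_b‖ ≤ e^{(1+κ)(‖B_b‖+‖B_bᴴ‖)}` for `0 ≤ a ≤ 1`, `aκr² = 1`;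
* `exists_norm_slavedSliceBlocks_sub_gibbsWeight_le` — **the `m`-block per-slice estimate**
  `‖e^{-a(H + (κ/2)Σ_b{B_b,B_bᴴ})} · Π_b S̄_b - e^{-aH}‖ ≤ C · a(aκr + a) = O(a^{3/2})`, by induction on
  the blocks from the single-block estimate (peel `B₀`: the single-block lemma with Hamiltonian
  `H + (κ/2)Σ_{b≥1}{B_b,B_bᴴ}`, then the induction hypothesis), for ANY `H` and any family `B`.

The Trotter limit for `m` blocks and the fully slaved (un-averaged) many-block weight are in
`…RSlavedTrotterBlocksLimit`.  Matrices carry the `L²` operator norm.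
-/

noncomputable section

namespace Summit.HubbardSuperconductivity.HubbardSuperconductivity.Theorems

open scoped Matrix.Norms.L2Operator ComplexConjugate
open Matrix Filter Topology NormedSpace
open Literature.MathematicalPhysics.QuantumLattice

variable {n : Type*} [Fintype n] [DecidableEq n]

/-! ### Distributivity of ordered products over configuration sums -/

/-- **Ordered products distribute over finite sums** (noncommutative): for `F : Fin m → ι → R`,
`Σ_{p : Fin m → ι} Π_b F_b (p_b) = Π_b Σ_k F_b k` (ordered products `List.ofFn … |>.prod`).
[folklore] -/
theorem sum_prod_ofFn_eq_prod_ofFn_sum {R : Type*} [Semiring R] {ι : Type*} [Fintype ι] :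
    ∀ {m : ℕ} (F : Fin m → ι → R),
      ∑ p : Fin m → ι, (List.ofFn fun b => F b (p b)).prod = (List.ofFn fun b => ∑ k, F b k).prod := by
  intro m
  induction m with
  | zero =>
    intro F
    simp only [List.ofFn_zero, List.prod_nil, Finset.sum_const, Finset.card_univ, Fintype.card_fun,
      Fintype.card_fin, pow_zero, one_smul]
  | succ m ih =>
    intro F
    rw [List.ofFn_succ, List.prod_cons, ← (Fin.consEquiv fun _ => ι).sum_comp, Fintype.sum_prod_type]
    simp only [Fin.consEquiv_apply, List.ofFn_succ, List.prod_cons, Fin.cons_zero, Fin.cons_succ]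
    rw [Finset.sum_mul]
    refine Finset.sum_congr rfl fun a _ => ?_
    rw [← Finset.mul_sum, ih (fun b => F b.succ)]

/-- Scalars pull out of ordered products: `Π_b (c • S_b) = c^m • Π_b S_b`. [folklore] -/
theorem prod_ofFn_smul {R : Type*} [Ring R] [Algebra ℂ R] :
    ∀ {m : ℕ} (c : ℂ) (S : Fin m → R),
      (List.ofFn fun b => c • S b).prod = c ^ m • (List.ofFn S).prod := by
  intro m
  induction m with
  | zero => intro c S; simp
  | succ m ih =>
    intro c S
    rw [List.ofFn_succ, List.prod_cons, List.ofFn_succ, List.prod_cons, ih, smul_mul_assoc,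
      mul_smul_comm, smul_smul, pow_succ']

/-- **Configuration average of a many-block slice = product of averaged single-block slices.**
`(1/4)^m • Σ_{p : Fin m → Fin 4} Π_b S_b(p_b) = Π_b (¼ Σ_k S_b k)`. [folklore] -/
theorem avg_config_prod_eq_prod_avg {R : Type*} [Ring R] [Algebra ℂ R] {m : ℕ}
    (S : Fin m → Fin 4 → R) :
    (1 / 4 : ℂ) ^ m • ∑ p : Fin m → Fin 4, (List.ofFn fun b => S b (p b)).prod =
      (List.ofFn fun b => (1 / 4 : ℂ) • ∑ k, S b k).prod := by
  have h := sum_prod_ofFn_eq_prod_ofFn_sum (fun b k => (1 / 4 : ℂ) • S b k)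
  simp only [prod_ofFn_smul, ← Finset.smul_sum] at h
  rw [prod_ofFn_smul]
  exact h

/-! ### Norm of an averaged single-block slice -/

/-- `‖¼Σ_k e^{aκ(conj φ_k B + φ_k Bᴴ)}‖ ≤ e^{(1+κ)(‖B‖+‖Bᴴ‖)}` for `0 ≤ a ≤ 1`, `r ≥ 0`, `aκr² = 1`.
[folklore] -/
theorem norm_avgSlice_le [Nonempty n] (B : Matrix n n ℂ) {κ : ℝ} (hκ : 0 ≤ κ) {a r : ℝ}
    (ha0 : 0 ≤ a) (ha1 : a ≤ 1) (hr : 0 ≤ r) (hakr : a * κ * r ^ 2 = 1) :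
    ‖(1 / 4 : ℂ) • ∑ k : Fin 4, gibbsWeight (-(a * κ))
        (conj ((r : ℂ) * Complex.I ^ (k : ℕ)) • B + ((r : ℂ) * Complex.I ^ (k : ℕ)) • Bᴴ)‖ ≤
      Real.exp ((1 + κ) * (‖B‖ + ‖Bᴴ‖)) := by
  obtain ⟨b, hb⟩ : ∃ b : ℝ, ‖B‖ + ‖Bᴴ‖ = b := ⟨_, rfl⟩
  have hb0 : 0 ≤ b := hb ▸ add_nonneg (norm_nonneg _) (norm_nonneg _)
  obtain ⟨s, hs⟩ : ∃ s : ℝ, a * κ * r = s := ⟨_, rfl⟩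
  have hs0 : 0 ≤ s := by rw [← hs]; positivity
  have hs2 : s ^ 2 = a * κ := by
    have e : s ^ 2 = (a * κ) * (a * κ * r ^ 2) := by rw [← hs]; ring
    rw [e, hakr, mul_one]
  have hs1 : s ≤ 1 + κ := by
    have h1 : s ^ 2 ≤ (1 + κ) ^ 2 := by
      rw [hs2]; nlinarith [mul_le_of_le_one_left hκ ha1, sq_nonneg κ]
    calc s = Real.sqrt (s ^ 2) := (Real.sqrt_sq hs0).symm
      _ ≤ Real.sqrt ((1 + κ) ^ 2) := Real.sqrt_le_sqrt h1
      _ = 1 + κ := Real.sqrt_sq (by positivity)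
  rw [hb]
  simp only [gibbsWeight, Complex.ofReal_neg, neg_neg]
  have hz : ∀ k : Fin 4, ‖((a * κ : ℝ) : ℂ) •
      (conj ((r : ℂ) * Complex.I ^ (k : ℕ)) • B + ((r : ℂ) * Complex.I ^ (k : ℕ)) • Bᴴ)‖ ≤ (1 + κ) * b := by
    intro k
    rw [norm_smul, Complex.norm_real, Real.norm_of_nonneg (by positivity : 0 ≤ a * κ)]
    have hW : ‖conj ((r : ℂ) * Complex.I ^ (k : ℕ)) • B + ((r : ℂ) * Complex.I ^ (k : ℕ)) • Bᴴ‖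
        ≤ r * b :=
      calc _ ≤ ‖conj ((r : ℂ) * Complex.I ^ (k : ℕ)) • B‖ + ‖((r : ℂ) * Complex.I ^ (k : ℕ)) • Bᴴ‖ :=
            norm_add_le _ _
        _ = r * b := by
            rw [norm_smul, norm_smul, Complex.norm_conj, norm_nu4, abs_of_nonneg hr, ← hb]; ring
    calc a * κ * _ ≤ a * κ * (r * b) := by gcongr
      _ = s * b := by rw [← hs]; ring
      _ ≤ (1 + κ) * b := mul_le_mul_of_nonneg_right hs1 hb0
  calc ‖(1 / 4 : ℂ) • ∑ k : Fin 4, exp (((a * κ : ℝ) : ℂ) •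
        (conj ((r : ℂ) * Complex.I ^ (k : ℕ)) • B + ((r : ℂ) * Complex.I ^ (k : ℕ)) • Bᴴ))‖
      ≤ ‖(1 / 4 : ℂ)‖ * ∑ k : Fin 4, ‖exp (((a * κ : ℝ) : ℂ) •
        (conj ((r : ℂ) * Complex.I ^ (k : ℕ)) • B + ((r : ℂ) * Complex.I ^ (k : ℕ)) • Bᴴ))‖ := by
        rw [norm_smul]; gcongr; exact norm_sum_le _ _
    _ ≤ ‖(1 / 4 : ℂ)‖ * ∑ _k : Fin 4, Real.exp ((1 + κ) * b) := by
        gcongr with k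
        exact (norm_exp_le ℂ _).trans (Real.exp_le_exp.mpr (hz k))
    _ = Real.exp ((1 + κ) * b) := by
        have h4 : ‖(1 / 4 : ℂ)‖ = 1 / 4 := by simp
        rw [Finset.sum_const, Finset.card_univ, Fintype.card_fin, nsmul_eq_mul, h4]
        push_cast
        ring

omit [DecidableEq n] in
/-- Norm of an ordered product of averaged slices: `‖Π_b S̄_b‖ ≤ Π_b R_b` if `‖S̄_b‖ ≤ R_b`.
[folklore] -/
theorem norm_prod_ofFn_le [Nonempty n] [DecidableEq n] {m : ℕ} (S : Fin m → Matrix n n ℂ)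
    (R : Fin m → ℝ) (h : ∀ b, ‖S b‖ ≤ R b) : ‖(List.ofFn S).prod‖ ≤ ∏ b, R b := by
  calc ‖(List.ofFn S).prod‖ ≤ ((List.ofFn S).map norm).prod := List.norm_prod_le _
    _ = ∏ b, ‖S b‖ := by rw [List.map_ofFn, List.prod_ofFn]; rfl
    _ ≤ ∏ b, R b := Finset.prod_le_prod (fun b _ => norm_nonneg _) (fun b _ => h b)

/-! ### The many-block per-slice estimate -/

/-- **`m`-block per-slice estimate of the slaved representation.** For any `H`, any family
`B : Fin m → Mat_n(ℂ)` and `κ ≥ 0` there is `C` with: for all `0 ≤ a ≤ 1`, `r ≥ 0`, `aκr² = 1`,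
`‖e^{-a(H + (κ/2)Σ_b (B_bB_bᴴ + B_bᴴB_b))} · Π_b ¼Σ_k e^{aκ(conj φ_k B_b + φ_k B_bᴴ)} - e^{-aH}‖ ≤ C·a(aκr + a)`.
Induction on `m`: peel the first block with the single-block estimate
`exists_norm_slavedSlice_sub_gibbsWeight_le` applied to the Hamiltonian `H + (κ/2)Σ_{b≥1}(…)`,
bound the remaining averaged slices by `norm_avgSlice_le`, and use the induction hypothesis.
[folklore] -/
theorem exists_norm_slavedSliceBlocks_sub_gibbsWeight_le [Nonempty n] (H : Matrix n n ℂ) {κ : ℝ}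
    (hκ : 0 ≤ κ) :
    ∀ {m : ℕ} (B : Fin m → Matrix n n ℂ), ∃ C : ℝ, ∀ a r : ℝ, 0 ≤ a → a ≤ 1 → 0 ≤ r →
      a * κ * r ^ 2 = 1 →
      ‖gibbsWeight a (H + ((κ / 2 : ℝ) : ℂ) • ∑ b, (B b * (B b)ᴴ + (B b)ᴴ * B b)) *
            (List.ofFn fun b => (1 / 4 : ℂ) • ∑ k : Fin 4, gibbsWeight (-(a * κ))
              (conj ((r : ℂ) * Complex.I ^ (k : ℕ)) • B b + ((r : ℂ) * Complex.I ^ (k : ℕ)) • (B b)ᴴ)).prod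
          - gibbsWeight a H‖ ≤ C * (a * (a * κ * r + a)) := by
  intro m
  induction m with
  | zero =>
    intro B
    refine ⟨0, fun a r _ _ _ _ => ?_⟩
    simp
  | succ m ih =>
    intro B
    obtain ⟨C₂, hC₂⟩ := ih (fun b => B b.succ)
    obtain ⟨C₁, hC₁⟩ := exists_norm_slavedSlice_sub_gibbsWeight_le
      (H + ((κ / 2 : ℝ) : ℂ) • ∑ b : Fin m, (B b.succ * (B b.succ)ᴴ + (B b.succ)ᴴ * B b.succ)) (B 0) hκ
    obtain ⟨Rt, hRt⟩ : ∃ Rt : ℝ, ∏ b : Fin m, Real.exp ((1 + κ) * (‖B b.succ‖ + ‖(B b.succ)ᴴ‖)) = Rt :=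
      ⟨_, rfl⟩
    refine ⟨C₁ * Rt + C₂, fun a r ha0 ha1 hr hakr => ?_⟩
    have h1 := hC₁ a r ha0 ha1 hr hakr
    have h2 := hC₂ a r ha0 ha1 hr hakr
    rw [Fin.sum_univ_succ, List.ofFn_succ, List.prod_cons]
    have e : H + ((κ / 2 : ℝ) : ℂ) • ((B 0 * (B 0)ᴴ + (B 0)ᴴ * B 0) +
        ∑ b : Fin m, (B b.succ * (B b.succ)ᴴ + (B b.succ)ᴴ * B b.succ)) =
        (H + ((κ / 2 : ℝ) : ℂ) • ∑ b : Fin m, (B b.succ * (B b.succ)ᴴ + (B b.succ)ᴴ * B b.succ)) +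
          ((κ / 2 : ℝ) : ℂ) • (B 0 * (B 0)ᴴ + (B 0)ᴴ * B 0) := by
      rw [smul_add]; abel
    rw [e, ← mul_assoc]
    -- names for the four players
    obtain ⟨G, hG⟩ : ∃ G : Matrix n n ℂ, gibbsWeight a
        ((H + ((κ / 2 : ℝ) : ℂ) • ∑ b : Fin m, (B b.succ * (B b.succ)ᴴ + (B b.succ)ᴴ * B b.succ)) +
          ((κ / 2 : ℝ) : ℂ) • (B 0 * (B 0)ᴴ + (B 0)ᴴ * B 0)) = G := ⟨_, rfl⟩
    obtain ⟨S₀, hS₀⟩ : ∃ S₀ : Matrix n n ℂ, (1 / 4 : ℂ) • ∑ k : Fin 4, gibbsWeight (-(a * κ))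
        (conj ((r : ℂ) * Complex.I ^ (k : ℕ)) • B 0 + ((r : ℂ) * Complex.I ^ (k : ℕ)) • (B 0)ᴴ) = S₀ :=
      ⟨_, rfl⟩
    obtain ⟨Gr, hGr⟩ : ∃ Gr : Matrix n n ℂ, gibbsWeight a
        (H + ((κ / 2 : ℝ) : ℂ) • ∑ b : Fin m, (B b.succ * (B b.succ)ᴴ + (B b.succ)ᴴ * B b.succ)) = Gr :=
      ⟨_, rfl⟩
    obtain ⟨P, hP⟩ : ∃ P : Matrix n n ℂ, (List.ofFn fun b : Fin m => (1 / 4 : ℂ) • ∑ k : Fin 4,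
        gibbsWeight (-(a * κ)) (conj ((r : ℂ) * Complex.I ^ (k : ℕ)) • B b.succ +
          ((r : ℂ) * Complex.I ^ (k : ℕ)) • (B b.succ)ᴴ)).prod = P := ⟨_, rfl⟩
    rw [hG, hS₀, hGr] at h1
    rw [hGr, hP] at h2
    rw [hG, hS₀, hP]
    have hPn : ‖P‖ ≤ Rt := by
      rw [← hP, ← hRt]
      exact norm_prod_ofFn_le _ _ fun b => norm_avgSlice_le (B b.succ) hκ ha0 ha1 hr hakr
    have key : G * S₀ * P - gibbsWeight a H = (G * S₀ - Gr) * P + (Gr * P - gibbsWeight a H) := by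
      noncomm_ring
    rw [key]
    have hnn : 0 ≤ C₁ * (a * (a * κ * r + a)) := (norm_nonneg _).trans h1
    calc ‖(G * S₀ - Gr) * P + (Gr * P - gibbsWeight a H)‖
        ≤ ‖G * S₀ - Gr‖ * ‖P‖ + ‖Gr * P - gibbsWeight a H‖ :=
          (norm_add_le _ _).trans (add_le_add (norm_mul_le _ _) le_rfl)
      _ ≤ (C₁ * (a * (a * κ * r + a))) * Rt + C₂ * (a * (a * κ * r + a)) :=
          add_le_add (mul_le_mul h1 hPn (norm_nonneg _) hnn) h2
      _ = (C₁ * Rt + C₂) * (a * (a * κ * r + a)) := by ring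

end Summit.HubbardSuperconductivity.HubbardSuperconductivity.Theorems

end
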